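import Summits.NavierStokesRegularity.FluidComputer.RowCircuitFlow
import Mathlib.Analysis.ODE.Gronwall
import HarnessLib

/-!
# The forced circuit has a global flow for every bounded continuous forcing
# (layer R, perturbed classes; `pub-fluidc-bp3/R1-DESIGN.md` §11.9, §11.11)

HONEST FRAMING (cell `pub-fluidc`, blueprint seat bp3, gen 22): low prior, high value-of-information
experiment on Tao's machine paradigm; NOT a claim that NS blows up.

WHAT. For an energy-conserving `C¹` field `Φ` on `ℝⁿ` (`∑ XᵢΦᵢ(X) = 0`) and a continuous forcing
`δ(t)` with `|δᵢ(t)| ≤ M`, the energy of a solution of `β' = Φ(β) + δ(t)` grows at most like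
`(E(0) + nM²)eᵗ` (`sum_sq_le_forced`, Grönwall on `E' = 2∑βᵢδᵢ ≤ E + nM²`); hence an a-priori
bound on every compact time interval, hence (by the cited global-existence theorem, forward for
`Φ + δ` and for the time-reversed field, glued at `t = 0`) a GLOBAL solution on `ℝ` through every
initial state (`exists_solution_real_forced`), in particular for the forced chain circuit
(`forced_solution`). This removes the existence hypothesis from the class-`U` robust transfer.

[cite: Tao2016AveragedNS, §5.5 Thm 5.3 (5.5)]
-/

noncomputable section

namespace Summit.NavierStokesRegularity.FluidComputer

open Literature.Analysis.FluidPDE.FluidComputer Literature.Analysis.ODE Set Metric Filter Topology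

open scoped NNReal BigOperators

namespace CircuitFlow

variable {n : ℕ}

/-- **Energy growth under forcing**: `∑βᵢ(t)² ≤ (∑βᵢ(a)² + nM²)·e^{t−a}` on `[a, s]`. [folklore] -/
theorem sum_sq_le_forced {Φ : (Fin n → ℝ) → (Fin n → ℝ)} (hΦ : ∀ X, ∑ i, X i * Φ X i = 0)
    {δ : ℝ → Fin n → ℝ} {M : ℝ} (hM : ∀ t i, |δ t i| ≤ M) {β : ℝ → Fin n → ℝ} {a s : ℝ}
    (hβ : ∀ t ∈ Icc a s, HasDerivWithinAt β (Φ (β t) + δ t) (Icc a s) t) :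
    ∀ t ∈ Icc a s, ∑ i, β t i ^ 2 ≤ (∑ i, β a i ^ 2 + n * M ^ 2) * Real.exp (t - a) := by
  have hcont : ContinuousOn β (Icc a s) := fun t ht => (hβ t ht).continuousWithinAt
  have hfc : ContinuousOn (fun t => ∑ i, β t i * β t i) (Icc a s) :=
    continuousOn_finsetSum _ fun i _ =>
      ((continuous_apply i).comp_continuousOn hcont).mul
        ((continuous_apply i).comp_continuousOn hcont)
  have hEsq : ∀ t, ∑ i, β t i * β t i = ∑ i, β t i ^ 2 := fun t =>
    Finset.sum_congr rfl fun i _ => by ring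
  have hEnn : ∀ t, 0 ≤ ∑ i, β t i * β t i := fun t => by rw [hEsq]; positivity
  have hnM : 0 ≤ (n : ℝ) * M ^ 2 := by positivity
  have hder : ∀ t ∈ Ico a s,
      HasDerivWithinAt (fun t => ∑ i, β t i * β t i) (2 * ∑ i, β t i * δ t i) (Ici t) t := by
    intro t ht
    have hβt : HasDerivWithinAt β (Φ (β t) + δ t) (Ici t) t :=
      (hβ t (Ico_subset_Icc_self ht)).mono_of_mem_nhdsWithin
        (mem_of_superset (Icc_mem_nhdsGE ht.2) (Icc_subset_Icc ht.1 le_rfl))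
    have h := HasDerivWithinAt.fun_sum (u := Finset.univ)
      fun i _ => ((hasDerivWithinAt_pi.1 hβt) i).mul ((hasDerivWithinAt_pi.1 hβt) i)
    refine h.congr_deriv ?_
    calc ∑ i ∈ Finset.univ, ((Φ (β t) + δ t) i * β t i + β t i * (Φ (β t) + δ t) i)
        = 2 * ∑ i, β t i * Φ (β t) i + 2 * ∑ i, β t i * δ t i := by
          rw [Finset.mul_sum, Finset.mul_sum, ← Finset.sum_add_distrib]
          exact Finset.sum_congr rfl fun i _ => by simp only [Pi.add_apply]; ring
      _ = 2 * ∑ i, β t i * δ t i := by rw [hΦ, mul_zero, zero_add]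
  have hbound : ∀ t ∈ Ico a s,
      ‖2 * ∑ i, β t i * δ t i‖ ≤ 1 * ‖∑ i, β t i * β t i‖ + n * M ^ 2 := by
    intro t _
    rw [Real.norm_eq_abs, Real.norm_eq_abs, one_mul, abs_of_nonneg (hEnn t), hEsq]
    have h1 : |2 * ∑ i, β t i * δ t i| ≤ ∑ i, (β t i ^ 2 + δ t i ^ 2) :=
      calc |2 * ∑ i, β t i * δ t i| = 2 * |∑ i, β t i * δ t i| := by
            rw [abs_mul, abs_two]
        _ ≤ 2 * ∑ i, |β t i * δ t i| := by
            gcongr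
            exact Finset.abs_sum_le_sum_abs _ _
        _ = ∑ i, 2 * |β t i * δ t i| := by rw [Finset.mul_sum]
        _ ≤ ∑ i, (β t i ^ 2 + δ t i ^ 2) := Finset.sum_le_sum fun i _ => by
            rw [abs_mul]
            nlinarith [sq_nonneg (|β t i| - |δ t i|), sq_abs (β t i), sq_abs (δ t i)]
    have h2 : ∑ i, δ t i ^ 2 ≤ n * M ^ 2 := by
      have h3 : ∑ i, δ t i ^ 2 ≤ ∑ _i : Fin n, M ^ 2 := Finset.sum_le_sum fun i _ => by
        have hi := hM t i
        have h0 : 0 ≤ M := (abs_nonneg _).trans hi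
        nlinarith [abs_nonneg (δ t i), sq_abs (δ t i)]
      simpa using h3
    rw [Finset.sum_add_distrib] at h1
    linarith
  have hgr := norm_le_gronwallBound_of_norm_deriv_right_le hfc hder le_rfl hbound
  intro t ht
  have h := hgr t ht
  rw [Real.norm_eq_abs, Real.norm_eq_abs, abs_of_nonneg (hEnn t), abs_of_nonneg (hEnn a), hEsq,
    hEsq] at h
  simp only [gronwallBound_of_K_ne_0 one_ne_zero, one_mul, div_one] at h
  rw [add_mul]
  nlinarith [Real.exp_pos (t - a)]

/-- **Forward global existence for the forced field** `Φ + δ(t)`. [folklore] -/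
theorem exists_solution_Ici_forced {Φ : (Fin n → ℝ) → (Fin n → ℝ)} (hΦc : ContDiff ℝ 1 Φ)
    (hΦ : ∀ X, ∑ i, X i * Φ X i = 0) {δ : ℝ → Fin n → ℝ} (hδc : Continuous δ) {M : ℝ}
    (hM : ∀ t i, |δ t i| ≤ M) (q₀ : Fin n → ℝ) :
    ∃ α : ℝ → Fin n → ℝ, α 0 = q₀ ∧
      (∀ t, 0 ≤ t → HasDerivWithinAt α (Φ (α t) + δ t) (Ici 0) t) ∧
      ∀ t, 0 < t → HasDerivAt α (Φ (α t) + δ t) t := by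
  have hlip : ∀ T ρ : ℝ, ∃ K : ℝ≥0, ∀ t ∈ Icc 0 T,
      LipschitzOnWith K (fun x => Φ x + δ t) (closedBall 0 ρ) := by
    intro T ρ
    obtain ⟨C, hC⟩ := exists_lipschitzOnWith_of_isCompact isOpen_univ hΦc.contDiffOn
      (isCompact_closedBall (0 : Fin n → ℝ) ρ) (subset_univ _)
    refine ⟨C, fun t _ x hx y hy => ?_⟩
    rw [edist_add_right]
    exact hC hx hy
  have hapriori : ∀ T : ℝ, 0 ≤ T → ∃ R : ℝ, ‖q₀‖ ≤ R ∧ ∀ s ∈ Icc 0 T, ∀ β : ℝ → Fin n → ℝ,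
      β 0 = q₀ → (∀ t ∈ Icc 0 s, HasDerivWithinAt β (Φ (β t) + δ t) (Icc 0 s) t) →
      ∀ t ∈ Icc 0 s, ‖β t‖ ≤ R := by
    intro T hT
    have hnM : 0 ≤ (n : ℝ) * M ^ 2 := by positivity
    refine ⟨Real.sqrt ((∑ i, q₀ i ^ 2 + n * M ^ 2) * Real.exp T), ?_, fun s hs β hβ0 hβ t ht => ?_⟩
    · refine (norm_le_sqrt_sum_sq q₀).trans (Real.sqrt_le_sqrt ?_)
      have h1 : (1 : ℝ) ≤ Real.exp T := Real.one_le_exp hT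
      nlinarith [Finset.sum_nonneg (fun i (_ : i ∈ Finset.univ) => sq_nonneg (q₀ i))]
    · have h := sum_sq_le_forced hΦ hM hβ t ht
      rw [hβ0, sub_zero] at h
      refine (norm_le_sqrt_sum_sq (β t)).trans (Real.sqrt_le_sqrt (h.trans ?_))
      have hq : 0 ≤ ∑ i, q₀ i ^ 2 + n * M ^ 2 := by positivity
      exact mul_le_mul_of_nonneg_left (Real.exp_le_exp.2 (ht.2.trans hs.2)) hq
  obtain ⟨α, h0, -, hIci, hpos⟩ := exists_solution_Ici_of_apriori_bound
    (v := fun t x => Φ x + δ t) (x₀ := q₀) hlip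
    (fun x => (continuous_const.add hδc).continuousOn) hapriori
  exact ⟨α, h0, hIci, hpos⟩

/-- **Global existence on `ℝ` for the forced field** (forward solutions of `Φ + δ(t)` and of the
time-reversed field `−Φ − δ(−t)`, glued at `t = 0`). [folklore] -/
theorem exists_solution_real_forced {Φ : (Fin n → ℝ) → (Fin n → ℝ)} (hΦc : ContDiff ℝ 1 Φ)
    (hΦ : ∀ X, ∑ i, X i * Φ X i = 0) {δ : ℝ → Fin n → ℝ} (hδc : Continuous δ) {M : ℝ}
    (hM : ∀ t i, |δ t i| ≤ M) (q₀ : Fin n → ℝ) :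
    ∃ α : ℝ → Fin n → ℝ, α 0 = q₀ ∧ ∀ t, HasDerivAt α (Φ (α t) + δ t) t := by
  obtain ⟨αp, h0p, hIcip, hposp⟩ := exists_solution_Ici_forced hΦc hΦ hδc hM q₀
  have hΦn : ∀ X, ∑ i, X i * (-Φ X) i = 0 := fun X => by
    simp only [Pi.neg_apply, mul_neg, Finset.sum_neg_distrib, hΦ X, neg_zero]
  have hδn : Continuous fun t => -δ (-t) := (hδc.comp continuous_neg).neg
  have hMn : ∀ t i, |(fun t => -δ (-t)) t i| ≤ M := fun t i => by
    simp only [Pi.neg_apply, abs_neg]; exact hM (-t) i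
  obtain ⟨αm, h0m, hIcim, hposm⟩ := exists_solution_Ici_forced hΦc.neg hΦn hδn hMn q₀
  have hfm : ∀ t, -Φ (αm (-t)) + (fun t => -δ (-t)) (-t) = -(Φ (αm (-t)) + δ t) := fun t => by
    simp only [neg_neg, neg_add]
  refine ⟨fun t => if 0 ≤ t then αp t else (αm ∘ Neg.neg) t, by simp [h0p], fun t => ?_⟩
  show HasDerivAt _ (Φ (if 0 ≤ t then αp t else (αm ∘ Neg.neg) t) + δ t) t
  rcases lt_trichotomy t 0 with ht | rfl | ht
  · have hev : (fun s => if 0 ≤ s then αp s else (αm ∘ Neg.neg) s) =ᶠ[𝓝 t] (αm ∘ Neg.neg) := by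
      filter_upwards [Iio_mem_nhds ht] with s hs
      rw [if_neg (not_le.2 hs)]
    have hd : HasDerivAt (αm ∘ Neg.neg) (Φ ((αm ∘ Neg.neg) t) + δ t) t := by
      have h1 := hposm (-t) (by linarith)
      have h2 := h1.scomp t (hasDerivAt_neg (x := t))
      rw [hfm, neg_smul, one_smul, neg_neg] at h2
      exact h2
    rw [if_neg (not_le.2 ht)]
    exact hd.congr_of_eventuallyEq hev
  · rw [if_pos le_rfl, h0p]
    have hr : HasDerivWithinAt (fun s => if 0 ≤ s then αp s else (αm ∘ Neg.neg) s)
        (Φ q₀ + δ 0) (Ici 0) 0 := by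
      have h1 := hIcip 0 le_rfl
      rw [h0p] at h1
      exact h1.congr (fun s hs => by rw [if_pos (mem_Ici.1 hs)]) (by simp [h0p])
    have hl : HasDerivWithinAt (fun s => if 0 ≤ s then αp s else (αm ∘ Neg.neg) s)
        (Φ q₀ + δ 0) (Iic 0) 0 := by
      have h1 := hIcim 0 le_rfl
      rw [h0m] at h1
      have h2 : HasDerivWithinAt (αm ∘ Neg.neg)
          ((-1 : ℝ) • (-Φ q₀ + (fun t => -δ (-t)) 0)) (Iic 0) 0 :=
        h1.scomp_of_eq (0 : ℝ) (hasDerivWithinAt_neg (x := (0 : ℝ)) (s := Iic 0))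
          (fun s hs => mem_Ici.2 (neg_nonneg.2 (mem_Iic.1 hs))) neg_zero.symm
      have he : (-1 : ℝ) • (-Φ q₀ + (fun t => -δ (-t)) 0) = Φ q₀ + δ 0 := by
        simp only [neg_zero, neg_smul, one_smul, neg_add, neg_neg]
      rw [he] at h2
      refine h2.congr (fun s hs => ?_) (by simp [h0p, h0m])
      rcases (mem_Iic.1 hs).lt_or_eq with hs' | rfl
      · rw [if_neg (not_le.2 hs')]
      · simp [h0p, h0m]
    have := hl.union hr
    rwa [Iic_union_Ici, hasDerivWithinAt_univ] at this
  · have hev : (fun s => if 0 ≤ s then αp s else (αm ∘ Neg.neg) s) =ᶠ[𝓝 t] αp := by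
      filter_upwards [Ioi_mem_nhds ht] with s hs
      rw [if_pos (le_of_lt hs)]
    rw [if_pos ht.le]
    exact (hposp t ht).congr_of_eventuallyEq hev

/-- **The forced chain circuit has a global solution through every state**, for every continuous
forcing bounded coordinatewise. [folklore] -/
theorem forced_solution (g : GateData) (Λ : ℝ) {δF : ℝ → Fin 9 → ℝ} (hδc : Continuous δF)
    {M : ℝ} (hM : ∀ t a, |δF t a| ≤ M) (q₀ : Fin 9 → ℝ) :
    ∃ y : ℝ → Fin 9 → ℝ, y 0 = q₀ ∧ ∀ t, HasDerivAt y (ChainField.F g Λ (y t) + δF t) t :=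
  exists_solution_real_forced (ChainField.contDiff_F g Λ) (fun X => ChainField.energy g Λ X)
    hδc hM q₀

end CircuitFlow

end Summit.NavierStokesRegularity.FluidComputer
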